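import Summits.BirchSwinnertonDyer.BirchSwinnertonDyer.Theorems.AlignedTransportAtTwoMainConjectureOfRankZeroBSDAtTwoCyclotomicLayerRoadMinus
import HarnessLib

/-!
# Route `AlignedTransportAtTwo`, crux C2 `MainConjectureOfRankZeroBSDAtTwo` (stmt-BirchSwinnertonDyer-22298):
# THE MORDELL–WEIL PROFILE OF THE `a₂ = −1` ROAD, `ord_{T=−2} L₂ = 1`, `λ₂ ≥ 5` — the `ι`-PAIR and SPLIT-PAIR rows `L₀ = (T+2)·Q·H` / `(T+2)·L₁·L₂·H`:
# the pair factor has the wrong weight / degree for every layer prime, so a jump above `ℚ(√2)` is carried by the Eisenstein `H` and forces `λ₂ = 2ⁿ + 3`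

HONEST FRAMING (cell `bsd-f1-sign2`, WIDTH-5 attached prover seat `bsd-line-att-p5` gen 37 on line `birth` of the lead `bsd-line-att-p2`;
`--supports` stmt-BirchSwinnertonDyer-22298, closes nothing; BSD is NOT proved by any of this; the crux C2, its verdict «blocked-on
`Rank1Residual.GreenbergMuConjectureIrreducible`» and every registered stub are untouched). THEOREMS ONLY — no `def`, no `sorry`, nothing asserted about any
particular curve. PRINT binders `h17` (Kato 17.4 (1)(2) at `2`) [+ `hGZK`]. Companion of `…CyclotomicLayerRoadMinus` (same gen: engine, `λ₂ = 3` row, `ord₋₂ = 3` row);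
the rows are those of the lineage's PRICE LIST (g35 `…EisensteinRigidityPrimeRoadRows`: conductors 1259, 3523, 4307 in g34's numerics).

* §1 THE `ι`-PAIR ROW: `G = (T+2)·Q·H`, `Q` PRIME with `λ(Q) = 2`, `‖Q(0)‖₂ = ¼` (the `ℚ₂`-irrational pair of valuation-one zeros — the row's one certificate), `a₂ = −1`, unit
  symbol. Then `‖H(0)‖₂ = ½` (Eisenstein ⇒ prime), `Q` has weight TWO so no layer prime is `~ Q`, and `ord_{T=−2} G = 1`:
  `exists_shape_of_negRoad_iotaPair`; ★★ `mordellWeilRank_layer_succ_eq_or_of_negRoad_iotaPair` (**one layer `n ≥ 1`: stationary OR jump EXACTLY `2ⁿ` with `λ₂ = 2ⁿ + 3`**);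
  ★★ `mordellWeilRank_layer_eq_or_of_negRoad_iotaPair` (**profile `rank W(ℚ_m) ∈ {r₁, r₁ + λ₂ − 3}`, at most one jump, in the layer `2ⁿ = λ₂ − 3`**);
  `mordellWeilRank_layer_le_one_or_of_negRoad_iotaPair` (**`+ hGZK`: `rank W(ℚ_m) ≤ 1` OR `λ₂ − 3 ≤ rank W(ℚ_m) ≤ λ₂ − 2`**);
  `mordellWeilRank_layer_le_one_of_negRoad_iotaPair_of_ne` (**`λ₂ − 3` not a power of two ⇒ `rank W(ℚ_m) ≤ 1` at every layer**). (1259: `λ₂ = 5`, only layer `2` admissible,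
  jump `2`; 3523/4307: `λ₂ = 7`, only layer `3`, jump `4`.)
* §2 THE SPLIT-PAIR ROW: `G = (T+2)·L₁·L₂·H` with `‖Lᵢ(0)‖₂ = ½`, `λ(Lᵢ) = 1` (no certificate): the `Lᵢ` have the wrong DEGREE for every layer `n+1 ≥ 2`, `H` is Eisenstein:
  `mordellWeilRank_layer_succ_eq_or_of_negRoad_splitPair`, `mordellWeilRank_layer_eq_or_of_negRoad_splitPair` (same dichotomy / profile with `λ₂ = 2ⁿ + 3`).

References: K. Kato, Astérisque 295 (2004), Thm. 17.4 [Kato2004Asterisque]; R. Greenberg, LNM 1716 (1999), Thm. 1.9 (p. 63), §5 pp. 132, 176–177, 181 [GreenbergLNM1716];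
L. Washington, GTM 83, §7.1, §13.2 [Washington1997].
-/

set_option linter.dupNamespace false
set_option autoImplicit false

noncomputable section

open scoped Classical MatrixGroups ModularForm Polynomial

namespace Summit.BirchSwinnertonDyer.BirchSwinnertonDyer.Theorems.AlignedTransportAtTwoCyclotomicLayerRoadMinusPairs

open Polynomial CongruenceSubgroup WeierstrassCurve Literature.NumberTheory.EllipticCurves
  Literature.NumberTheory.EllipticCurves.ModularForms
  Literature.NumberTheory.EllipticCurves.Rank1Residual
  Literature.NumberTheory.EllipticCurves.Rank1Residual.Typed
  Literature.NumberTheory.EllipticCurves.Greenberg1999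
  Summit.BirchSwinnertonDyer.Rank1Residual
  Summit.BirchSwinnertonDyer.Rank1Residual.X1.MuLambda
  Summit.BirchSwinnertonDyer.Rank1Residual.X1.CyclotomicZeros
  Summit.BirchSwinnertonDyer.Rank1Residual.X1.ParitySqueeze
  Summit.BirchSwinnertonDyer.Rank1Residual.Iwasawa
  Summit.BirchSwinnertonDyer.Rank1Residual.F1Sign2
  Summit.BirchSwinnertonDyer.BirchSwinnertonDyer.Theorems.AlignedTransportAtTwoSeed
  Summit.BirchSwinnertonDyer.BirchSwinnertonDyer.Theorems.AlignedTransportAtTwoTwoFixedPoints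
  Summit.BirchSwinnertonDyer.BirchSwinnertonDyer.Theorems.AlignedTransportAtTwoRoadSecondFixedPoint
  Summit.BirchSwinnertonDyer.BirchSwinnertonDyer.Theorems.AlignedTransportAtTwoEisensteinRigidity
  Summit.BirchSwinnertonDyer.BirchSwinnertonDyer.Theorems.AlignedTransportAtTwoEisensteinRigidityConservation
  Summit.BirchSwinnertonDyer.BirchSwinnertonDyer.Theorems.AlignedTransportAtTwoEisensteinRigidityPrime
  Summit.BirchSwinnertonDyer.BirchSwinnertonDyer.Theorems.AlignedTransportAtTwoLayerOneRankBound
  Summit.BirchSwinnertonDyer.BirchSwinnertonDyer.Theorems.AlignedTransportAtTwoCyclotomicLayerPrime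
  Summit.BirchSwinnertonDyer.BirchSwinnertonDyer.Theorems.AlignedTransportAtTwoCyclotomicLayerRankDichotomy
  Summit.BirchSwinnertonDyer.BirchSwinnertonDyer.Theorems.AlignedTransportAtTwoCyclotomicLayerLFunction
  Summit.BirchSwinnertonDyer.BirchSwinnertonDyer.Theorems.AlignedTransportAtTwoCyclotomicLayerWeight
  Summit.BirchSwinnertonDyer.BirchSwinnertonDyer.Theorems.AlignedTransportAtTwoCyclotomicLayerWeightBudget
  Summit.BirchSwinnertonDyer.BirchSwinnertonDyer.Theorems.AlignedTransportAtTwoCyclotomicLayerRoadMinus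
  Summit.BirchSwinnertonDyer.BirchSwinnertonDyer.Theorems.DefectPrime

/-- (pure `Λ`-algebra, `p = 2`) **`T + 2 ∣ P`, `P` irreducible ⇒ `λ(P) = 1`** (`T + 2 = Φ₂(1+T)` is the layer-one prime `Ψ_0`). [cite: Washington1997, §13.2] -/
theorem lam_eq_one_of_X_add_C_two_dvd_of_irreducible {P : PowerSeries ℤ_[2]} (hP : Irreducible P)
    (h : (PowerSeries.X + PowerSeries.C (2 : ℤ_[2])) ∣ P) : lam P = 1 := by
  rw [← xi_two, ← coe_cyclotomicLayer_zero] at h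
  have := (lam_mu_norm_of_cyclotomicLayer_dvd_of_irreducible hP h).1
  simpa using this

variable (W : WeierstrassCurve ℚ) [W.IsElliptic] [W.IsGloballyMinimal]

/-! ## §1 The `ι`-pair row -/

/-- **The shape of the `ι`-pair row.** `W` globally minimal, good ordinary at `2`, `a₂ = −1`, `∏ c_v` odd, `Δ_min ≡ 3,5 (8)`, unit central symbol; `G = (T+2)·Q·H` an integral lift
with `Q` prime, `λ(Q) = 2`, `‖Q(0)‖₂ = ¼`. Then: no layer prime `Ψ_m` (`m ≥ 1`; weight one) divides `Q` (weight two); `‖H(0)‖₂ = ½`, so `H` is PRIME; `λ(G) = 3 + λ(H)` with `λ(H)`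
EVEN (`λ(G)` odd on the road); and `ord_{T=−2} G = 1` (`T+2 ∤ Q`: degree; `T+2 ∤ H`: `H ~ T+2` would have `λ(H) = 1`). [cite: Washington1997, §7.1 and §13.2]
[cite: GreenbergLNM1716, §5 pp. 176–178 and 181] -/
theorem exists_shape_of_negRoad_iotaPair [NeZero (W.conductorNorm ℤ)] {f : CuspForm (Gamma0 (W.conductorNorm ℤ)) 2}
    (hord : IsOrdinaryAt W 2) (hf : IsNewformOf W f) (ha : W.frobeniusTrace 2 = -1) (hodd : Odd W.tamagawaProduct)
    (hΔ : minimalDiscriminantInt W % 8 = 3 ∨ minimalDiscriminantInt W % 8 = 5)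
    {G Q H : IwasawaAlgebra 2} (hG : iwasawaToPowerSeries 2 G = padicLFunction f (unitRoot W 2 : ℚ_[2]))
    (hGQH : G = (PowerSeries.X + PowerSeries.C (2 : ℤ_[2])) * (Q * H)) (hQ : Prime Q) (hlamQ : lam Q = 2)
    (hQn : ‖PowerSeries.constantCoeff Q‖ = (2 : ℝ)⁻¹ ^ 2) (hsym : ‖(ratPlusSymbol f 0 : ℚ_[2])‖ = 1) :
    G = (PowerSeries.X + PowerSeries.C (2 : ℤ_[2])) ^ 1 * (Q * H) ∧
      (∀ m, 1 ≤ m → ¬ (((cyclotomic (2 ^ (m + 1)) ℤ_[2]).comp (X + 1) : ℤ_[2][X]) : PowerSeries ℤ_[2]) ∣ Q) ∧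
      Irreducible H ∧ ‖PowerSeries.constantCoeff H‖ = (2 : ℝ)⁻¹ ∧ lam G = 3 + lam H ∧ Even (lam H) ∧ HasOrderAtNegTwo G 1 := by
  have hX : Prime (PowerSeries.X + PowerSeries.C (2 : ℤ_[2]) : PowerSeries ℤ_[2]) := prime_X_add_C_two
  have hG0 : G ≠ 0 := by
    intro h0
    rw [h0, map_zero] at hG
    exact padicLFunction_unitRoot_ne_zero hord hf hG.symm
  have hG1 : iwasawaToPowerSeries 2 G = PowerSeries.C (1 : ℚ_[2]) * padicLFunction f (unitRoot W 2 : ℚ_[2]) := by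
    rw [map_one, one_mul]; exact hG
  have hQH0 : Q * H ≠ 0 := by rintro h0; exact hG0 (by rw [hGQH, h0, mul_zero])
  have hQ0 : Q ≠ 0 := left_ne_zero_of_mul hQH0
  have hH0 : H ≠ 0 := right_ne_zero_of_mul hQH0
  -- weight of `Q` is two: no layer prime is `~ Q`
  have hQw : ‖PowerSeries.constantCoeff Q‖ ≠ ((2 : ℕ) : ℝ)⁻¹ := by rw [hQn]; norm_num
  have hM : ∀ m, 1 ≤ m → ¬ (((cyclotomic (2 ^ (m + 1)) ℤ_[2]).comp (X + 1) : ℤ_[2][X]) : PowerSeries ℤ_[2]) ∣ Q :=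
    fun m _ ↦ not_cyclotomicLayer_dvd_of_irreducible_of_norm_ne hQ.irreducible hQw m
  -- `‖H(0)‖ = ½`
  have hGn : ‖PowerSeries.constantCoeff G‖ = (2 : ℝ)⁻¹ ^ (3 + 1) := norm_constantCoeff_lift_of_frobeniusTrace_eq_neg_one W hord hf ha hG hsym
  have hHn : ‖PowerSeries.constantCoeff H‖ = (2 : ℝ)⁻¹ := by
    have h1 : ‖PowerSeries.constantCoeff G‖ = (2 : ℝ)⁻¹ ^ 1 * ((2 : ℝ)⁻¹ ^ 2 * ‖PowerSeries.constantCoeff H‖) := by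
      rw [hGQH, ← pow_one (PowerSeries.X + PowerSeries.C (2 : ℤ_[2])), map_mul, norm_mul, norm_constantCoeff_X_add_C_two_pow, map_mul, norm_mul, hQn]
    rw [hGn, show (2 : ℝ)⁻¹ ^ (3 + 1) = (2 : ℝ)⁻¹ ^ 1 * ((2 : ℝ)⁻¹ ^ 2 * 2⁻¹) by ring] at h1
    have hpos : (0 : ℝ) < (2 : ℝ)⁻¹ ^ 1 := by positivity
    have hpos2 : (0 : ℝ) < (2 : ℝ)⁻¹ ^ 2 := by positivity
    exact (mul_left_cancel₀ hpos2.ne' (mul_left_cancel₀ hpos.ne' h1)).symm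
  have hHirr : Irreducible H := (prime_of_norm_constantCoeff_eq_half hHn).irreducible
  -- `λ(G) = 3 + λ(H)`, odd
  have hlamG : lam G = 3 + lam H := by
    rw [hGQH, lam_mul hX.ne_zero hQH0, lam_mul hQ0 hH0, lam_X_add_C_two, hlamQ]; ring
  have hoddG : Odd (lam G) := odd_lam_of_road hord hf hodd hΔ hG1 hG0
  have hevenH : Even (lam H) := by
    rw [hlamG] at hoddG
    obtain ⟨b, hb⟩ := hoddG
    exact ⟨b - 1, by omega⟩
  -- `ord_{T=−2} G = 1`
  have hord1 : HasOrderAtNegTwo G 1 := by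
    refine ⟨by rw [pow_one, hGQH]; exact dvd_mul_right _ _, ?_⟩
    intro h2
    rw [hGQH, pow_succ, pow_one] at h2
    have h3 : (PowerSeries.X + PowerSeries.C (2 : ℤ_[2])) ∣ Q * H := (mul_dvd_mul_iff_left hX.ne_zero).mp h2
    rcases hX.dvd_or_dvd h3 with hq | hh
    · have := lam_eq_one_of_X_add_C_two_dvd_of_irreducible hQ.irreducible hq
      omega
    · have h1 := lam_eq_one_of_X_add_C_two_dvd_of_irreducible hHirr hh
      rw [h1] at hevenH
      exact Nat.not_even_one hevenH
  exact ⟨by rw [pow_one]; exact hGQH, hM, hHirr, hHn, hlamG, hevenH, hord1⟩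

/-- ★★ **ONE LAYER OF THE `ι`-PAIR ROW (`n ≥ 1`): `rank W(ℚ_{n+1}) = rank W(ℚ_n)`, OR (`rank W(ℚ_{n+1}) = rank W(ℚ_n) + 2ⁿ` EXACTLY ∧ `λ(G) = 2ⁿ + 3`).** Hypotheses of
`exists_shape_of_negRoad_iotaPair` + PRINT `h17`; `κ` the cyclotomic `ℤ₂`-extension with normalised generator. The weight-two prime `Q` hosts no layer prime, so a jump is carried
by the Eisenstein `H ~ Φ_{2^{n+1}}(1+T)`: `λ₂ − 3 = λ(H) = 2ⁿ`. [cite: Kato2004Asterisque, Thm. 17.4 (1)(2) (p. 273)] [cite: GreenbergLNM1716, §5 pp. 177 and 181] -/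
theorem mordellWeilRank_layer_succ_eq_or_of_negRoad_iotaPair [NeZero (W.conductorNorm ℤ)] {f : CuspForm (Gamma0 (W.conductorNorm ℤ)) 2}
    (h17 : kato_divisibility_allPrimes W 2 (f := f)) (hord : IsOrdinaryAt W 2) (hf : IsNewformOf W f) (ha : W.frobeniusTrace 2 = -1)
    (hodd : Odd W.tamagawaProduct) (hΔ : minimalDiscriminantInt W % 8 = 3 ∨ minimalDiscriminantInt W % 8 = 5)
    {G Q H : IwasawaAlgebra 2} (hG : iwasawaToPowerSeries 2 G = padicLFunction f (unitRoot W 2 : ℚ_[2]))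
    (hGQH : G = (PowerSeries.X + PowerSeries.C (2 : ℤ_[2])) * (Q * H)) (hQ : Prime Q) (hlamQ : lam Q = 2)
    (hQn : ‖PowerSeries.constantCoeff Q‖ = (2 : ℝ)⁻¹ ^ 2) (hsym : ‖(ratPlusSymbol f 0 : ℚ_[2])‖ = 1)
    {κ : ZpExtension ℚ 2} {γ : Field.absoluteGaloisGroup ℚ} (hκ : κ.IsCyclotomic) (hγ : κ.IsTopGenerator γ)
    (hγ' : IsCyclotomicVariable 2 γ) {n : ℕ} (hn : 1 ≤ n) :
    (W.baseChange (κ.layer (n + 1))).mordellWeilRank = (W.baseChange (κ.layer n)).mordellWeilRank ∨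
      ((W.baseChange (κ.layer (n + 1))).mordellWeilRank = (W.baseChange (κ.layer n)).mordellWeilRank + 2 ^ n ∧ lam G = 2 ^ n + 3) := by
  obtain ⟨hshape, hM, hirr, -, hlamG, -, -⟩ := exists_shape_of_negRoad_iotaPair W hord hf ha hodd hΔ hG hGQH hQ hlamQ hQn hsym
  rcases mordellWeilRank_layer_succ_eq_or_of_shape W h17 hord hf hG hshape hM hirr hκ hγ hγ' hn with h | ⟨h, hl⟩
  · exact Or.inl h
  · exact Or.inr ⟨h, by rw [hlamG, hl, add_comm]⟩

/-- ★★ **THE PROFILE OF THE `ι`-PAIR ROW**: for every `m ≥ 1`, **`rank W(ℚ_m) = rank W(ℚ₁)` OR (`rank W(ℚ_m) = rank W(ℚ₁) + (λ(G) − 3)` ∧ `λ(G) = 2ⁿ + 3`, `1 ≤ n < m`)** —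
above `ℚ(√2)` at most ONE jump, of size exactly `λ₂ − 3`, in the layer `ℚ_{n+1}/ℚ_n` with `2ⁿ = λ₂ − 3` (`λ₂ = 5`: layer `2`, size `2`; `λ₂ = 7`: layer `3`, size `4`).
[cite: Kato2004Asterisque, Thm. 17.4 (1)(2) (p. 273)] [cite: GreenbergLNM1716, Thm. 1.9 (p. 63) and §5 p. 177] -/
theorem mordellWeilRank_layer_eq_or_of_negRoad_iotaPair [NeZero (W.conductorNorm ℤ)] {f : CuspForm (Gamma0 (W.conductorNorm ℤ)) 2}
    (h17 : kato_divisibility_allPrimes W 2 (f := f)) (hord : IsOrdinaryAt W 2) (hf : IsNewformOf W f) (ha : W.frobeniusTrace 2 = -1)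
    (hodd : Odd W.tamagawaProduct) (hΔ : minimalDiscriminantInt W % 8 = 3 ∨ minimalDiscriminantInt W % 8 = 5)
    {G Q H : IwasawaAlgebra 2} (hG : iwasawaToPowerSeries 2 G = padicLFunction f (unitRoot W 2 : ℚ_[2]))
    (hGQH : G = (PowerSeries.X + PowerSeries.C (2 : ℤ_[2])) * (Q * H)) (hQ : Prime Q) (hlamQ : lam Q = 2)
    (hQn : ‖PowerSeries.constantCoeff Q‖ = (2 : ℝ)⁻¹ ^ 2) (hsym : ‖(ratPlusSymbol f 0 : ℚ_[2])‖ = 1)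
    {κ : ZpExtension ℚ 2} {γ : Field.absoluteGaloisGroup ℚ} (hκ : κ.IsCyclotomic) (hγ : κ.IsTopGenerator γ)
    (hγ' : IsCyclotomicVariable 2 γ) {m : ℕ} (hm : 1 ≤ m) :
    (W.baseChange (κ.layer m)).mordellWeilRank = (W.baseChange (κ.layer 1)).mordellWeilRank ∨
      ((W.baseChange (κ.layer m)).mordellWeilRank = (W.baseChange (κ.layer 1)).mordellWeilRank + (lam G - 3) ∧
        ∃ n, 1 ≤ n ∧ n < m ∧ lam G = 2 ^ n + 3) := by
  obtain ⟨hshape, hM, hirr, -, hlamG, -, -⟩ := exists_shape_of_negRoad_iotaPair W hord hf ha hodd hΔ hG hGQH hQ hlamQ hQn hsym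
  rcases mordellWeilRank_layer_eq_or_eq_add_of_shape W h17 hord hf hG hshape hM hirr hκ hγ hγ' hm with h | ⟨h, n, hn1, hnm, hl⟩
  · exact Or.inl h
  · refine Or.inr ⟨by rw [h, hlamG, Nat.add_sub_cancel_left], n, hn1, hnm, by rw [hlamG, hl, add_comm]⟩

/-- ★★ **`+ hGZK`: on the `ι`-pair row, at every layer `m ≥ 1`, `rank W(ℚ_m) ≤ 1` OR `λ₂ − 3 ≤ rank W(ℚ_m) ≤ λ₂ − 2`** (`rank W(ℚ) = 0`, `rank W(ℚ₁) ≤ 1` since `ord_{T=−2} G = 1`).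
In the second case the lineage's door certificate `LayerRankGEAt W 2 m 2` holds. [cite: Kato2004Asterisque, Thm. 17.4 (1)(2) (p. 273)] [cite: GreenbergLNM1716, §5 pp. 176 and 181] -/
theorem mordellWeilRank_layer_le_one_or_of_negRoad_iotaPair [NeZero (W.conductorNorm ℤ)] {f : CuspForm (Gamma0 (W.conductorNorm ℤ)) 2}
    (h17 : kato_divisibility_allPrimes W 2 (f := f)) (hGZK : rank_eq_analyticRank_of_analyticRank_le_one)
    (hord : IsOrdinaryAt W 2) (hf : IsNewformOf W f) (hr : W.analyticRank = 0) (ha : W.frobeniusTrace 2 = -1)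
    (hodd : Odd W.tamagawaProduct) (hΔ : minimalDiscriminantInt W % 8 = 3 ∨ minimalDiscriminantInt W % 8 = 5)
    {G Q H : IwasawaAlgebra 2} (hG : iwasawaToPowerSeries 2 G = padicLFunction f (unitRoot W 2 : ℚ_[2]))
    (hGQH : G = (PowerSeries.X + PowerSeries.C (2 : ℤ_[2])) * (Q * H)) (hQ : Prime Q) (hlamQ : lam Q = 2)
    (hQn : ‖PowerSeries.constantCoeff Q‖ = (2 : ℝ)⁻¹ ^ 2) (hsym : ‖(ratPlusSymbol f 0 : ℚ_[2])‖ = 1)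
    {κ : ZpExtension ℚ 2} {γ : Field.absoluteGaloisGroup ℚ} (hκ : κ.IsCyclotomic) (hγ : κ.IsTopGenerator γ)
    (hγ' : IsCyclotomicVariable 2 γ) {m : ℕ} (hm : 1 ≤ m) :
    (W.baseChange (κ.layer m)).mordellWeilRank ≤ 1 ∨
      (lam G - 3 ≤ (W.baseChange (κ.layer m)).mordellWeilRank ∧ (W.baseChange (κ.layer m)).mordellWeilRank ≤ lam G - 2) := by
  obtain ⟨-, -, -, -, -, -, h1⟩ := exists_shape_of_negRoad_iotaPair W hord hf ha hodd hΔ hG hGQH hQ hlamQ hQn hsym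
  have hrk : W.mordellWeilRank = 0 := by rw [(hGZK W (by rw [hr]; exact zero_le_one)).1, hr]
  have hle1 : (W.baseChange (κ.layer 1)).mordellWeilRank ≤ W.mordellWeilRank + 1 :=
    mordellWeilRank_layer_one_le_add_orderAtNegTwo W h17 hord hf hG h1 hκ hγ hγ'
  rcases mordellWeilRank_layer_eq_or_of_negRoad_iotaPair W h17 hord hf ha hodd hΔ hG hGQH hQ hlamQ hQn hsym hκ hγ hγ' hm
    with h | ⟨h, n, -, -, hl⟩
  · left; omega
  · right
    have h2n : 1 ≤ 2 ^ n := Nat.one_le_two_pow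
    constructor <;> omega

/-- ★ **`λ₂ − 3` NOT A POWER OF TWO (`2ⁿ`, `n ≥ 1`) ⇒ `rank W(ℚ_m) ≤ 1` AT EVERY LAYER of the `ι`-pair row** (`+ hGZK`): the rank is stationary above `ℚ(√2)` and `≤ 1` there.
[cite: Kato2004Asterisque, Thm. 17.4 (1)(2) (p. 273)] [cite: GreenbergLNM1716, §5 pp. 176–177] -/
theorem mordellWeilRank_layer_le_one_of_negRoad_iotaPair_of_ne [NeZero (W.conductorNorm ℤ)] {f : CuspForm (Gamma0 (W.conductorNorm ℤ)) 2}
    (h17 : kato_divisibility_allPrimes W 2 (f := f)) (hGZK : rank_eq_analyticRank_of_analyticRank_le_one)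
    (hord : IsOrdinaryAt W 2) (hf : IsNewformOf W f) (hr : W.analyticRank = 0) (ha : W.frobeniusTrace 2 = -1)
    (hodd : Odd W.tamagawaProduct) (hΔ : minimalDiscriminantInt W % 8 = 3 ∨ minimalDiscriminantInt W % 8 = 5)
    {G Q H : IwasawaAlgebra 2} (hG : iwasawaToPowerSeries 2 G = padicLFunction f (unitRoot W 2 : ℚ_[2]))
    (hGQH : G = (PowerSeries.X + PowerSeries.C (2 : ℤ_[2])) * (Q * H)) (hQ : Prime Q) (hlamQ : lam Q = 2)
    (hQn : ‖PowerSeries.constantCoeff Q‖ = (2 : ℝ)⁻¹ ^ 2) (hsym : ‖(ratPlusSymbol f 0 : ℚ_[2])‖ = 1)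
    (hne : ∀ n, 1 ≤ n → lam G ≠ 2 ^ n + 3)
    {κ : ZpExtension ℚ 2} {γ : Field.absoluteGaloisGroup ℚ} (hκ : κ.IsCyclotomic) (hγ : κ.IsTopGenerator γ)
    (hγ' : IsCyclotomicVariable 2 γ) (m : ℕ) : (W.baseChange (κ.layer m)).mordellWeilRank ≤ 1 := by
  obtain ⟨-, -, -, -, -, -, h1⟩ := exists_shape_of_negRoad_iotaPair W hord hf ha hodd hΔ hG hGQH hQ hlamQ hQn hsym
  have hrk : W.mordellWeilRank = 0 := by rw [(hGZK W (by rw [hr]; exact zero_le_one)).1, hr]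
  have hle1 : (W.baseChange (κ.layer 1)).mordellWeilRank ≤ W.mordellWeilRank + 1 :=
    mordellWeilRank_layer_one_le_add_orderAtNegTwo W h17 hord hf hG h1 hκ hγ hγ'
  rcases Nat.eq_zero_or_pos m with rfl | hm
  · have h01 : (W.baseChange (κ.layer 0)).mordellWeilRank ≤ (W.baseChange (κ.layer (0 + 1))).mordellWeilRank :=
      mordellWeilRank_layer_le_succ W κ 0
    have h01' : (W.baseChange (κ.layer 0)).mordellWeilRank ≤ (W.baseChange (κ.layer 1)).mordellWeilRank := h01
    omega
  · rcases mordellWeilRank_layer_eq_or_of_negRoad_iotaPair W h17 hord hf ha hodd hΔ hG hGQH hQ hlamQ hQn hsym hκ hγ hγ' hm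
      with h | ⟨-, n, hn1, -, hl⟩
    · omega
    · exact absurd hl (hne n hn1)

/-! ## §2 The split-pair row -/

/-- **The shape of the split-pair row.** `G = (T+2)·L₁·L₂·H`, `‖Lᵢ(0)‖₂ = ½`, `λ(Lᵢ) = 1`, `a₂ = −1`, unit symbol, road: `M = L₁·L₂` hosts no layer prime `Ψ_m`, `m ≥ 1`
(`λ(Lᵢ) = 1 < 2^m`), `‖H(0)‖₂ = ½` so `H` is PRIME, `λ(G) = 3 + λ(H)`. [cite: Washington1997, §7.1 and §13.2] [cite: GreenbergLNM1716, §5 pp. 176–178] -/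
theorem exists_shape_of_negRoad_splitPair [NeZero (W.conductorNorm ℤ)] {f : CuspForm (Gamma0 (W.conductorNorm ℤ)) 2}
    (hord : IsOrdinaryAt W 2) (hf : IsNewformOf W f) (ha : W.frobeniusTrace 2 = -1)
    {G L₁ L₂ H : IwasawaAlgebra 2} (hG : iwasawaToPowerSeries 2 G = padicLFunction f (unitRoot W 2 : ℚ_[2]))
    (hGLH : G = (PowerSeries.X + PowerSeries.C (2 : ℤ_[2])) * (L₁ * (L₂ * H)))
    (hL₁n : ‖PowerSeries.constantCoeff L₁‖ = (2 : ℝ)⁻¹) (hlamL₁ : lam L₁ = 1) (hL₂n : ‖PowerSeries.constantCoeff L₂‖ = (2 : ℝ)⁻¹) (hlamL₂ : lam L₂ = 1)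
    (hsym : ‖(ratPlusSymbol f 0 : ℚ_[2])‖ = 1) :
    G = (PowerSeries.X + PowerSeries.C (2 : ℤ_[2])) ^ 1 * ((L₁ * L₂) * H) ∧
      (∀ m, 1 ≤ m → ¬ (((cyclotomic (2 ^ (m + 1)) ℤ_[2]).comp (X + 1) : ℤ_[2][X]) : PowerSeries ℤ_[2]) ∣ L₁ * L₂) ∧
      Irreducible H ∧ ‖PowerSeries.constantCoeff H‖ = (2 : ℝ)⁻¹ ∧ lam G = 3 + lam H := by
  have hX : Prime (PowerSeries.X + PowerSeries.C (2 : ℤ_[2]) : PowerSeries ℤ_[2]) := prime_X_add_C_two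
  have hG0 : G ≠ 0 := by
    intro h0
    rw [h0, map_zero] at hG
    exact padicLFunction_unitRoot_ne_zero hord hf hG.symm
  have hshape : G = (PowerSeries.X + PowerSeries.C (2 : ℤ_[2])) ^ 1 * ((L₁ * L₂) * H) := by rw [pow_one, hGLH, mul_assoc]
  have hLLH0 : L₁ * L₂ * H ≠ 0 := by rintro h0; exact hG0 (by rw [hshape, h0, mul_zero])
  have hLL0 : L₁ * L₂ ≠ 0 := left_ne_zero_of_mul hLLH0
  have hH0 : H ≠ 0 := right_ne_zero_of_mul hLLH0
  have hL₁0 : L₁ ≠ 0 := left_ne_zero_of_mul hLL0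
  have hL₂0 : L₂ ≠ 0 := right_ne_zero_of_mul hLL0
  -- the linear primes have the wrong degree for every layer `m ≥ 1`
  have hM : ∀ m, 1 ≤ m → ¬ (((cyclotomic (2 ^ (m + 1)) ℤ_[2]).comp (X + 1) : ℤ_[2][X]) : PowerSeries ℤ_[2]) ∣ L₁ * L₂ := by
    intro m hm h
    have h2 : 2 ≤ 2 ^ m * (2 - 1) := by simpa using Nat.pow_le_pow_right two_pos hm
    rcases (prime_coe_cyclotomic_comp 2 m).dvd_or_dvd h with h1 | h1
    · exact not_cyclotomicLayer_dvd_of_lam_lt hL₁0 (by rw [hlamL₁]; omega) h1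
    · exact not_cyclotomicLayer_dvd_of_lam_lt hL₂0 (by rw [hlamL₂]; omega) h1
  -- `‖H(0)‖ = ½`
  have hGn : ‖PowerSeries.constantCoeff G‖ = (2 : ℝ)⁻¹ ^ (3 + 1) := norm_constantCoeff_lift_of_frobeniusTrace_eq_neg_one W hord hf ha hG hsym
  have hHn : ‖PowerSeries.constantCoeff H‖ = (2 : ℝ)⁻¹ := by
    have h1 : ‖PowerSeries.constantCoeff G‖ = (2 : ℝ)⁻¹ ^ 1 * ((2 : ℝ)⁻¹ * (2 : ℝ)⁻¹ * ‖PowerSeries.constantCoeff H‖) := by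
      rw [hshape, map_mul, norm_mul, norm_constantCoeff_X_add_C_two_pow, map_mul, norm_mul, map_mul, norm_mul, hL₁n, hL₂n]
    rw [hGn, show (2 : ℝ)⁻¹ ^ (3 + 1) = (2 : ℝ)⁻¹ ^ 1 * ((2 : ℝ)⁻¹ * (2 : ℝ)⁻¹ * 2⁻¹) by ring] at h1
    have hpos : (0 : ℝ) < (2 : ℝ)⁻¹ ^ 1 := by positivity
    have hpos2 : (0 : ℝ) < (2 : ℝ)⁻¹ * (2 : ℝ)⁻¹ := by positivity
    exact (mul_left_cancel₀ hpos2.ne' (mul_left_cancel₀ hpos.ne' h1)).symm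
  have hlamG : lam G = 3 + lam H := by
    rw [hshape, pow_one, lam_mul hX.ne_zero hLLH0, lam_mul hLL0 hH0, lam_mul hL₁0 hL₂0, lam_X_add_C_two, hlamL₁, hlamL₂]; ring
  exact ⟨hshape, hM, (prime_of_norm_constantCoeff_eq_half hHn).irreducible, hHn, hlamG⟩

/-- ★★ **ONE LAYER OF THE SPLIT-PAIR ROW (`n ≥ 1`): `rank W(ℚ_{n+1}) = rank W(ℚ_n)`, OR (`rank W(ℚ_{n+1}) = rank W(ℚ_n) + 2ⁿ` ∧ `λ(G) = 2ⁿ + 3`)** (PRINT `h17`; no certificate).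
[cite: Kato2004Asterisque, Thm. 17.4 (1)(2) (p. 273)] [cite: GreenbergLNM1716, §5 pp. 177 and 181] -/
theorem mordellWeilRank_layer_succ_eq_or_of_negRoad_splitPair [NeZero (W.conductorNorm ℤ)] {f : CuspForm (Gamma0 (W.conductorNorm ℤ)) 2}
    (h17 : kato_divisibility_allPrimes W 2 (f := f)) (hord : IsOrdinaryAt W 2) (hf : IsNewformOf W f) (ha : W.frobeniusTrace 2 = -1)
    {G L₁ L₂ H : IwasawaAlgebra 2} (hG : iwasawaToPowerSeries 2 G = padicLFunction f (unitRoot W 2 : ℚ_[2]))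
    (hGLH : G = (PowerSeries.X + PowerSeries.C (2 : ℤ_[2])) * (L₁ * (L₂ * H)))
    (hL₁n : ‖PowerSeries.constantCoeff L₁‖ = (2 : ℝ)⁻¹) (hlamL₁ : lam L₁ = 1) (hL₂n : ‖PowerSeries.constantCoeff L₂‖ = (2 : ℝ)⁻¹) (hlamL₂ : lam L₂ = 1)
    (hsym : ‖(ratPlusSymbol f 0 : ℚ_[2])‖ = 1)
    {κ : ZpExtension ℚ 2} {γ : Field.absoluteGaloisGroup ℚ} (hκ : κ.IsCyclotomic) (hγ : κ.IsTopGenerator γ)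
    (hγ' : IsCyclotomicVariable 2 γ) {n : ℕ} (hn : 1 ≤ n) :
    (W.baseChange (κ.layer (n + 1))).mordellWeilRank = (W.baseChange (κ.layer n)).mordellWeilRank ∨
      ((W.baseChange (κ.layer (n + 1))).mordellWeilRank = (W.baseChange (κ.layer n)).mordellWeilRank + 2 ^ n ∧ lam G = 2 ^ n + 3) := by
  obtain ⟨hshape, hM, hirr, -, hlamG⟩ := exists_shape_of_negRoad_splitPair W hord hf ha hG hGLH hL₁n hlamL₁ hL₂n hlamL₂ hsym
  rcases mordellWeilRank_layer_succ_eq_or_of_shape W h17 hord hf hG hshape hM hirr hκ hγ hγ' hn with h | ⟨h, hl⟩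
  · exact Or.inl h
  · exact Or.inr ⟨h, by rw [hlamG, hl, add_comm]⟩

/-- ★★ **THE PROFILE OF THE SPLIT-PAIR ROW**: for every `m ≥ 1`, `rank W(ℚ_m) = rank W(ℚ₁)` OR (`rank W(ℚ_m) = rank W(ℚ₁) + (λ(G) − 3)` ∧ `λ(G) = 2ⁿ + 3`, `1 ≤ n < m`).
[cite: Kato2004Asterisque, Thm. 17.4 (1)(2) (p. 273)] [cite: GreenbergLNM1716, Thm. 1.9 (p. 63) and §5 p. 177] -/
theorem mordellWeilRank_layer_eq_or_of_negRoad_splitPair [NeZero (W.conductorNorm ℤ)] {f : CuspForm (Gamma0 (W.conductorNorm ℤ)) 2}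
    (h17 : kato_divisibility_allPrimes W 2 (f := f)) (hord : IsOrdinaryAt W 2) (hf : IsNewformOf W f) (ha : W.frobeniusTrace 2 = -1)
    {G L₁ L₂ H : IwasawaAlgebra 2} (hG : iwasawaToPowerSeries 2 G = padicLFunction f (unitRoot W 2 : ℚ_[2]))
    (hGLH : G = (PowerSeries.X + PowerSeries.C (2 : ℤ_[2])) * (L₁ * (L₂ * H)))
    (hL₁n : ‖PowerSeries.constantCoeff L₁‖ = (2 : ℝ)⁻¹) (hlamL₁ : lam L₁ = 1) (hL₂n : ‖PowerSeries.constantCoeff L₂‖ = (2 : ℝ)⁻¹) (hlamL₂ : lam L₂ = 1)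
    (hsym : ‖(ratPlusSymbol f 0 : ℚ_[2])‖ = 1)
    {κ : ZpExtension ℚ 2} {γ : Field.absoluteGaloisGroup ℚ} (hκ : κ.IsCyclotomic) (hγ : κ.IsTopGenerator γ)
    (hγ' : IsCyclotomicVariable 2 γ) {m : ℕ} (hm : 1 ≤ m) :
    (W.baseChange (κ.layer m)).mordellWeilRank = (W.baseChange (κ.layer 1)).mordellWeilRank ∨
      ((W.baseChange (κ.layer m)).mordellWeilRank = (W.baseChange (κ.layer 1)).mordellWeilRank + (lam G - 3) ∧
        ∃ n, 1 ≤ n ∧ n < m ∧ lam G = 2 ^ n + 3) := by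
  obtain ⟨hshape, hM, hirr, -, hlamG⟩ := exists_shape_of_negRoad_splitPair W hord hf ha hG hGLH hL₁n hlamL₁ hL₂n hlamL₂ hsym
  rcases mordellWeilRank_layer_eq_or_eq_add_of_shape W h17 hord hf hG hshape hM hirr hκ hγ hγ' hm with h | ⟨h, n, hn1, hnm, hl⟩
  · exact Or.inl h
  · refine Or.inr ⟨by rw [h, hlamG, Nat.add_sub_cancel_left], n, hn1, hnm, by rw [hlamG, hl, add_comm]⟩

end Summit.BirchSwinnertonDyer.BirchSwinnertonDyer.Theorems.AlignedTransportAtTwoCyclotomicLayerRoadMinusPairs
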